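import Summits.QuantumFields.YangMills.Theorems.LuscherReductionTwistedTraceScalingSpectralWeight
import Summits.QuantumFields.YangMills.Theorems.LuscherReductionTwistedTraceScalingHarmonicStepFrame
import HarnessLib

/-!
# Size and Lipschitz bounds for the canonical trial exponent `q_D(G) = ⟨D†G, g(D†D) D†G⟩`
# (covariant programme, brick c4(iii)-weight II)

Cell `ym-fleet`, crux `TwistedTraceScaling` (stmt-QuantumFields-20203), line «twolattice», stub S-BASE, lane B = COARSE-LOWER(L₁)
(design note `pub/ym-fleet/ym-20203-coarse-s1/LOWER-BLUEPRINT.md` §5–§6).  HONEST FRAMING: finite-dimensional quadratic-form bookkeeping; a stub of a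
child of the CONDITIONAL reduction route (femto rung R2b1); not a gap, not Clay.

The trial state `H(V) = exp(−q_{D_V}(F(V)))·…` is compared along a step `V = W·U` with the Gaussian model `exp(−q_{D_U}(F(U) + D_U w))`; the
curvature argument moves by the c1 remainder (`Cov.abs_plaqCurv_mul_sub_covCurl_le`), so one needs the modulus of `G ↦ q_D(G)`:

* `weightForm_le_of_mul_le` — if `g(s)·s ≤ m` for `s ≥ 0` then `q_D(G) ≤ m·‖G‖²` (frame formula + Bessel `Harm.sum_sq_div_le_norm_sq`:
  `Σᵢ g(λᵢ)φᵢ² = Σᵢ (g(λᵢ)λᵢ)(φᵢ²/λᵢ) ≤ m Σᵢ φᵢ²/λᵢ ≤ m‖G‖²`); for the Riccati weight `g(λ)λ = √(t² + 2tb/λ)`, bounded on `λ ≥ μ_*`;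
* ★ `abs_weightForm_sub_le` — `|q_D(G₁) − q_D(G₂)| ≤ m · ‖G₁ − G₂‖ · ‖G₁ + G₂‖` (Cauchy–Schwarz in the eigenframe), and the convenient
  `abs_weightForm_sub_le'` with `‖G₁‖ + ‖G₂‖`;
* `weightForm_smul` — homogeneity `q_D(c•G) = c² q_D(G)`; `exp_neg_weightForm_le` — the exponential form;
* `riccatiWeight t b μ_*` — the programme's weight function `g(λ) = √(t² + 2tb/λ')/λ'`, `λ' = max λ μ_*`: EXACTLY Riccati on stiff modes
  `λ ≥ μ_*` (`riccatiWeight_riccati`), below the Riccati envelope everywhere (`riccatiWeight_sq_le`, so every mode gains: super-solution direction),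
  with size constant `g(λ)λ ≤ √(t² + 2tb/μ_*)` (`riccatiWeight_mul_le`).

## References
* R. A. Horn, C. R. Johnson, *Matrix Analysis* (2nd ed., 2013), Thm 4.1.5, Thm 7.3.2. [HornJohnson2013]
* M. Lüscher, Nucl. Phys. B219 (1983) 233, §3. [Luscher1983]
-/

noncomputable section

open Real
open scoped RealInnerProductSpace

namespace Summit.QuantumFields.YangMills.Theorems.FemtoTransferGap.TwoLattice.Harm

variable {n : Type*} [Fintype n] [DecidableEq n]
variable {W : Type*} [NormedAddCommGroup W] [InnerProductSpace ℝ W] [FiniteDimensional ℝ W]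

/-! ## §1 Size -/

/-- One mode: `g(λ)φ² ≤ m·(φ²/λ)` when `g(λ)λ ≤ m`, `λ ≥ 0` and `λ = 0 ⇒ φ = 0`. [folklore] -/
theorem mode_weight_le {g : ℝ → ℝ} {m lam φ : ℝ} (hgm : g lam * lam ≤ m) (hlam : 0 ≤ lam) (hφ : lam = 0 → φ = 0) :
    g lam * φ ^ 2 ≤ m * (φ ^ 2 / lam) := by
  rcases hlam.eq_or_lt with h0 | hpos
  · rw [hφ h0.symm]; simp
  · have : g lam * φ ^ 2 = (g lam * lam) * (φ ^ 2 / lam) := by field_simp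
    rw [this]
    exact mul_le_mul_of_nonneg_right hgm (by positivity)

/-- ★ **SIZE OF THE TRIAL EXPONENT**: if `g(s)·s ≤ m` for all `s ≥ 0`, then `q_D(G) ≤ m‖G‖²`. [cite: HornJohnson2013, Thm 7.3.2] -/
theorem weightForm_le_of_mul_le {g : ℝ → ℝ} {m : ℝ} (hgm : ∀ s, 0 ≤ s → g s * s ≤ m)
    (D : EuclideanSpace ℝ n →ₗ[ℝ] W) (G : W) : weightForm g D G ≤ m * ‖G‖ ^ 2 := by
  have hD := gram_frame D
  rw [weightForm_eq_sum g D hD G]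
  have hm : 0 ≤ m := by simpa using hgm 0 le_rfl
  calc ∑ i, g ((gramMatrix_isHermitian D).eigenvalues i) * ⟪D ((gramMatrix_isHermitian D).eigenvectorBasis i), G⟫ ^ 2
      ≤ ∑ i, m * (⟪D ((gramMatrix_isHermitian D).eigenvectorBasis i), G⟫ ^ 2 / (gramMatrix_isHermitian D).eigenvalues i) :=
        Finset.sum_le_sum fun i _ => mode_weight_le (hgm _ (gram_eigenvalues_nonneg D i)) (gram_eigenvalues_nonneg D i)
          fun hi => inner_map_eq_zero_of_eigenvalue hD hi G
    _ = m * ∑ i, ⟪D ((gramMatrix_isHermitian D).eigenvectorBasis i), G⟫ ^ 2 / (gramMatrix_isHermitian D).eigenvalues i := by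
        rw [Finset.mul_sum]
    _ ≤ m * ‖G‖ ^ 2 := mul_le_mul_of_nonneg_left (sum_sq_div_le_norm_sq hD G) hm

/-- Homogeneity: `q_D(c • G) = c² q_D(G)`. [cite: HornJohnson2013, Thm 4.1.5] -/
theorem weightForm_smul (g : ℝ → ℝ) (D : EuclideanSpace ℝ n →ₗ[ℝ] W) (c : ℝ) (G : W) :
    weightForm g D (c • G) = c ^ 2 * weightForm g D G := by
  rw [weightForm_eq_sum_gram, weightForm_eq_sum_gram, Finset.mul_sum]
  refine Finset.sum_congr rfl fun i _ => ?_
  rw [inner_smul_right]; ring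

/-- `q_D(−G) = q_D(G)`. [cite: HornJohnson2013, Thm 4.1.5] -/
theorem weightForm_neg (g : ℝ → ℝ) (D : EuclideanSpace ℝ n →ₗ[ℝ] W) (G : W) : weightForm g D (-G) = weightForm g D G := by
  rw [show -G = (-1 : ℝ) • G by simp, weightForm_smul]; ring

/-! ## §2 Modulus in the curvature argument -/

/-- Weighted Cauchy–Schwarz: for `gᵢ ≥ 0`, `|Σᵢ gᵢ aᵢ bᵢ| ≤ √(Σᵢ gᵢaᵢ²) · √(Σᵢ gᵢbᵢ²)`. [folklore] -/
theorem abs_sum_mul_mul_le_sqrt {ι : Type*} (s : Finset ι) {w a b : ι → ℝ} (hw : ∀ i, 0 ≤ w i) :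
    |∑ i ∈ s, w i * a i * b i| ≤ Real.sqrt (∑ i ∈ s, w i * a i ^ 2) * Real.sqrt (∑ i ∈ s, w i * b i ^ 2) := by
  have h := Finset.sum_mul_sq_le_sq_mul_sq s (fun i => Real.sqrt (w i) * a i) (fun i => Real.sqrt (w i) * b i)
  have e1 : ∀ i, Real.sqrt (w i) * a i * (Real.sqrt (w i) * b i) = w i * a i * b i := fun i => by
    rw [show Real.sqrt (w i) * a i * (Real.sqrt (w i) * b i) = Real.sqrt (w i) * Real.sqrt (w i) * a i * b i by ring,
      Real.mul_self_sqrt (hw i)]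
  have e2 : ∀ i, (Real.sqrt (w i) * a i) ^ 2 = w i * a i ^ 2 := fun i => by rw [mul_pow, Real.sq_sqrt (hw i)]
  have e3 : ∀ i, (Real.sqrt (w i) * b i) ^ 2 = w i * b i ^ 2 := fun i => by rw [mul_pow, Real.sq_sqrt (hw i)]
  simp only [e1, e2, e3] at h
  have hA : 0 ≤ ∑ i ∈ s, w i * a i ^ 2 := Finset.sum_nonneg fun i _ => mul_nonneg (hw i) (sq_nonneg _)
  have hB : 0 ≤ ∑ i ∈ s, w i * b i ^ 2 := Finset.sum_nonneg fun i _ => mul_nonneg (hw i) (sq_nonneg _)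
  rw [← Real.sqrt_mul hA, ← Real.sqrt_sq_eq_abs]
  exact Real.sqrt_le_sqrt h

/-- ★ **MODULUS OF THE TRIAL EXPONENT**: if `g ≥ 0` and `g(s)s ≤ m` for `s ≥ 0`, then `|q_D(G₁) − q_D(G₂)| ≤ m · ‖G₁ − G₂‖ · ‖G₁ + G₂‖`.
[cite: HornJohnson2013, Thm 7.3.2] -/
theorem abs_weightForm_sub_le {g : ℝ → ℝ} (hg : ∀ s, 0 ≤ g s) {m : ℝ} (hgm : ∀ s, 0 ≤ s → g s * s ≤ m)
    (D : EuclideanSpace ℝ n →ₗ[ℝ] W) (G₁ G₂ : W) :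
    |weightForm g D G₁ - weightForm g D G₂| ≤ m * ‖G₁ - G₂‖ * ‖G₁ + G₂‖ := by
  have hD := gram_frame D
  set e := (gramMatrix_isHermitian D).eigenvectorBasis
  set lam := (gramMatrix_isHermitian D).eigenvalues
  have hm : 0 ≤ m := by simpa using hgm 0 le_rfl
  -- the difference as a weighted sum of products
  have hdiff : weightForm g D G₁ - weightForm g D G₂ =
      ∑ i, g (lam i) * ⟪D (e i), G₁ - G₂⟫ * ⟪D (e i), G₁ + G₂⟫ := by
    rw [weightForm_eq_sum g D hD G₁, weightForm_eq_sum g D hD G₂, ← Finset.sum_sub_distrib]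
    refine Finset.sum_congr rfl fun i _ => ?_
    rw [inner_sub_right, inner_add_right]; ring
  rw [hdiff]
  refine (abs_sum_mul_mul_le_sqrt Finset.univ fun i => hg (lam i)).trans ?_
  have hq1 : ∑ i, g (lam i) * ⟪D (e i), G₁ - G₂⟫ ^ 2 ≤ m * ‖G₁ - G₂‖ ^ 2 := by
    have := weightForm_le_of_mul_le hgm D (G₁ - G₂); rwa [weightForm_eq_sum g D hD] at this
  have hq2 : ∑ i, g (lam i) * ⟪D (e i), G₁ + G₂⟫ ^ 2 ≤ m * ‖G₁ + G₂‖ ^ 2 := by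
    have := weightForm_le_of_mul_le hgm D (G₁ + G₂); rwa [weightForm_eq_sum g D hD] at this
  calc Real.sqrt (∑ i, g (lam i) * ⟪D (e i), G₁ - G₂⟫ ^ 2) * Real.sqrt (∑ i, g (lam i) * ⟪D (e i), G₁ + G₂⟫ ^ 2)
      ≤ Real.sqrt (m * ‖G₁ - G₂‖ ^ 2) * Real.sqrt (m * ‖G₁ + G₂‖ ^ 2) :=
        mul_le_mul (Real.sqrt_le_sqrt hq1) (Real.sqrt_le_sqrt hq2) (Real.sqrt_nonneg _) (Real.sqrt_nonneg _)
    _ = m * ‖G₁ - G₂‖ * ‖G₁ + G₂‖ := by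
        rw [Real.sqrt_mul hm, Real.sqrt_mul hm, Real.sqrt_sq (norm_nonneg _), Real.sqrt_sq (norm_nonneg _)]
        rw [show Real.sqrt m * ‖G₁ - G₂‖ * (Real.sqrt m * ‖G₁ + G₂‖) = (Real.sqrt m * Real.sqrt m) * ‖G₁ - G₂‖ * ‖G₁ + G₂‖ by ring,
          Real.mul_self_sqrt hm]

/-- The same with `‖G₁‖ + ‖G₂‖` in place of `‖G₁ + G₂‖`. [cite: HornJohnson2013, Thm 7.3.2] -/
theorem abs_weightForm_sub_le' {g : ℝ → ℝ} (hg : ∀ s, 0 ≤ g s) {m : ℝ} (hgm : ∀ s, 0 ≤ s → g s * s ≤ m)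
    (D : EuclideanSpace ℝ n →ₗ[ℝ] W) (G₁ G₂ : W) :
    |weightForm g D G₁ - weightForm g D G₂| ≤ m * ‖G₁ - G₂‖ * (‖G₁‖ + ‖G₂‖) := by
  have hm : 0 ≤ m := by simpa using hgm 0 le_rfl
  exact (abs_weightForm_sub_le hg hgm D G₁ G₂).trans (mul_le_mul_of_nonneg_left (norm_add_le _ _) (by positivity))

/-- ★ Exponential form used by the step theorems: `e^{−q_D(G₁)} ≤ e^{m‖G₁−G₂‖(‖G₁‖+‖G₂‖)} · e^{−q_D(G₂)}`. [cite: Luscher1983, §3] -/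
theorem exp_neg_weightForm_le {g : ℝ → ℝ} (hg : ∀ s, 0 ≤ g s) {m : ℝ} (hgm : ∀ s, 0 ≤ s → g s * s ≤ m)
    (D : EuclideanSpace ℝ n →ₗ[ℝ] W) (G₁ G₂ : W) :
    Real.exp (-weightForm g D G₁) ≤ Real.exp (m * ‖G₁ - G₂‖ * (‖G₁‖ + ‖G₂‖)) * Real.exp (-weightForm g D G₂) := by
  rw [← Real.exp_add, Real.exp_le_exp]
  have h := abs_weightForm_sub_le' hg hgm D G₁ G₂
  have := neg_abs_le (weightForm g D G₁ - weightForm g D G₂)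
  linarith

/-! ## §3 The Riccati weight with a spectral floor -/

/-- The RICCATI weight function of the covariant programme, with the floor `μ_*` on the eigenvalue:
`g(λ) = √(t² + 2tb/λ')/λ'`, `λ' = max λ μ_*` — so that `g(λ)λ² = √((tλ)² + 2tλb)` (the Riccati value) for `λ ≥ μ_* > 0`,
and `g` is bounded (the low modes `λ < μ_*` receive a FATTER-than-Riccati weight). [cite: Wipf2021, §8.5.1 (8.57)] [cite: Luscher1983, §3] -/
def riccatiWeight (t b μ : ℝ) (lam : ℝ) : ℝ := Real.sqrt (t ^ 2 + 2 * t * b / max lam μ) / max lam μ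

/-- `g ≥ 0` (for `μ > 0`, `t, b ≥ 0`). [cite: Wipf2021, §8.5.1 (8.57)] -/
theorem riccatiWeight_nonneg {t b μ : ℝ} (hμ : 0 < μ) (lam : ℝ) : 0 ≤ riccatiWeight t b μ lam :=
  div_nonneg (Real.sqrt_nonneg _) (hμ.le.trans (le_max_right _ _))

/-- On a stiff mode (`λ ≥ μ_* > 0`) the weight is EXACTLY Riccati: `(g(λ)λ²)² = (tλ)² + 2(tλ)b` (`t, b ≥ 0`). [cite: Wipf2021, §8.5.1 (8.57)] -/
theorem riccatiWeight_riccati {t b μ lam : ℝ} (hμ : 0 < μ) (ht : 0 ≤ t) (hb : 0 ≤ b) (hlam : μ ≤ lam) :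
    (riccatiWeight t b μ lam * lam ^ 2) ^ 2 = (t * lam) ^ 2 + 2 * (t * lam) * b := by
  have hl : 0 < lam := hμ.trans_le hlam
  unfold riccatiWeight
  rw [max_eq_left hlam]
  have e : Real.sqrt (t ^ 2 + 2 * t * b / lam) / lam * lam ^ 2 = Real.sqrt (t ^ 2 + 2 * t * b / lam) * lam := by
    rw [div_mul_eq_mul_div, div_eq_iff hl.ne']; ring
  rw [e, mul_pow, Real.sq_sqrt (by positivity)]
  field_simp

/-- The size constant: `g(λ)·λ ≤ √(t² + 2tb/μ_*)` for every `λ ≥ 0` (`μ_* > 0`, `t, b ≥ 0`). [cite: Wipf2021, §8.5.1 (8.57)] -/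
theorem riccatiWeight_mul_le {t b μ : ℝ} (hμ : 0 < μ) (ht : 0 ≤ t) (hb : 0 ≤ b) {lam : ℝ} (hlam : 0 ≤ lam) :
    riccatiWeight t b μ lam * lam ≤ Real.sqrt (t ^ 2 + 2 * t * b / μ) := by
  unfold riccatiWeight
  have hM : μ ≤ max lam μ := le_max_right _ _
  have hMpos : 0 < max lam μ := hμ.trans_le hM
  have h1 : Real.sqrt (t ^ 2 + 2 * t * b / max lam μ) ≤ Real.sqrt (t ^ 2 + 2 * t * b / μ) :=
    Real.sqrt_le_sqrt (by gcongr)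
  have h2 : lam / max lam μ ≤ 1 := (div_le_one hMpos).mpr (le_max_left _ _)
  calc Real.sqrt (t ^ 2 + 2 * t * b / max lam μ) / max lam μ * lam
      = Real.sqrt (t ^ 2 + 2 * t * b / max lam μ) * (lam / max lam μ) := by ring
    _ ≤ Real.sqrt (t ^ 2 + 2 * t * b / μ) * 1 := mul_le_mul h1 h2 (by positivity) (Real.sqrt_nonneg _)
    _ = _ := mul_one _

/-- Below the Riccati envelope everywhere: `(g(λ)λ²)² ≤ (tλ)² + 2(tλ)b` for all `λ ≥ 0` — so every mode's gain `stepGain λ t b (g λ)` is `≥ 0`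
(`Harm.stepGain_nonneg_of_le`): the capped weight is a SUPER-solution weight. [cite: Wipf2021, §8.5.1 (8.57)] -/
theorem riccatiWeight_sq_le {t b μ : ℝ} (hμ : 0 < μ) (ht : 0 ≤ t) (hb : 0 ≤ b) {lam : ℝ} (hlam : 0 ≤ lam) :
    (riccatiWeight t b μ lam * lam ^ 2) ^ 2 ≤ (t * lam) ^ 2 + 2 * (t * lam) * b := by
  by_cases h : μ ≤ lam
  · exact (riccatiWeight_riccati hμ ht hb h).le
  · push Not at h
    unfold riccatiWeight
    rw [max_eq_right h.le]
    -- `(√(t²+2tb/μ)/μ · λ²)² = (t² + 2tb/μ) λ⁴/μ² ≤ t²λ² + 2tλb` for `λ ≤ μ`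
    rw [mul_pow, div_pow, Real.sq_sqrt (by positivity)]
    have hl2 : lam ^ 2 ≤ μ ^ 2 := pow_le_pow_left₀ hlam h.le 2
    have hμ2 : 0 < μ ^ 2 := by positivity
    rw [div_mul_eq_mul_div, div_le_iff₀ hμ2]
    have e : (lam ^ 2) ^ 2 = lam ^ 2 * lam ^ 2 := by ring
    rw [e]
    have h3 : (t ^ 2 + 2 * t * b / μ) * (lam ^ 2 * lam ^ 2) ≤ (t ^ 2 + 2 * t * b / μ) * (lam ^ 2 * μ ^ 2) :=
      mul_le_mul_of_nonneg_left (mul_le_mul_of_nonneg_left hl2 (sq_nonneg _)) (by positivity)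
    refine h3.trans ?_
    have h4 : 2 * t * b / μ * (lam ^ 2 * μ ^ 2) = 2 * t * b * lam ^ 2 * μ := by field_simp
    have h5 : 2 * t * b * lam ^ 2 * μ ≤ 2 * (t * lam) * b * μ ^ 2 := by
      have : lam * μ ≤ μ * μ := mul_le_mul_of_nonneg_right h.le hμ.le
      nlinarith [mul_nonneg (mul_nonneg ht hb) hlam]
    nlinarith [h4, h5, sq_nonneg (t * lam)]

/-! ## §4 Constants of the Riccati weight: sup and Lipschitz (appended 2026-08-27, g1) -/

/-- ★ SUP: `g(λ) ≤ √(t² + 2tb/μ_*)/μ_*` for every `λ` (`μ_* > 0`, `t, b ≥ 0`). [cite: Wipf2021, §8.5.1 (8.57)] -/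
theorem riccatiWeight_le {t b μ : ℝ} (hμ : 0 < μ) (ht : 0 ≤ t) (hb : 0 ≤ b) (lam : ℝ) :
    riccatiWeight t b μ lam ≤ Real.sqrt (t ^ 2 + 2 * t * b / μ) / μ := by
  unfold riccatiWeight
  have hM : μ ≤ max lam μ := le_max_right _ _
  have hMpos : 0 < max lam μ := hμ.trans_le hM
  have h1 : Real.sqrt (t ^ 2 + 2 * t * b / max lam μ) ≤ Real.sqrt (t ^ 2 + 2 * t * b / μ) :=
    Real.sqrt_le_sqrt (by gcongr)
  exact div_le_div₀ (Real.sqrt_nonneg _) h1 hμ hM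

/-- The radicand function `R(m) = √(t²m² + 2tbm)` on `m > 0`: `R(m)/m² = g` at `m = max λ μ_*`. [folklore] -/
theorem riccatiWeight_eq_div {t b μ : ℝ} (hμ : 0 < μ) (lam : ℝ) :
    riccatiWeight t b μ lam = Real.sqrt (t ^ 2 * (max lam μ) ^ 2 + 2 * t * b * max lam μ) / (max lam μ) ^ 2 := by
  unfold riccatiWeight
  have hM : 0 < max lam μ := hμ.trans_le (le_max_right _ _)
  rw [show t ^ 2 * max lam μ ^ 2 + 2 * t * b * max lam μ = (t ^ 2 + 2 * t * b / max lam μ) * (max lam μ) ^ 2 by field_simp,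
    Real.sqrt_mul' _ (sq_nonneg _), Real.sqrt_sq hM.le]
  field_simp

/-- Lipschitz bound of `R(m) = √(t²m² + 2tbm)` on `[μ_*, ∞)`: `|R(m₁) − R(m₂)| ≤ (t + b/μ_*)|m₁ − m₂|` (`t > 0`, `b ≥ 0`). [folklore] -/
theorem abs_sqrt_rad_sub_le {t b μ m₁ m₂ : ℝ} (hμ : 0 < μ) (ht : 0 < t) (hb : 0 ≤ b) (h1 : μ ≤ m₁) (h2 : μ ≤ m₂) :
    |Real.sqrt (t ^ 2 * m₁ ^ 2 + 2 * t * b * m₁) - Real.sqrt (t ^ 2 * m₂ ^ 2 + 2 * t * b * m₂)| ≤ (t + b / μ) * |m₁ - m₂| := by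
  have hm1 : 0 < m₁ := hμ.trans_le h1
  have hm2 : 0 < m₂ := hμ.trans_le h2
  set R₁ := Real.sqrt (t ^ 2 * m₁ ^ 2 + 2 * t * b * m₁)
  set R₂ := Real.sqrt (t ^ 2 * m₂ ^ 2 + 2 * t * b * m₂)
  have hR1 : t * m₁ ≤ R₁ := by
    rw [← Real.sqrt_sq (by positivity : 0 ≤ t * m₁)]
    exact Real.sqrt_le_sqrt (by nlinarith [mul_nonneg (mul_nonneg ht.le hb) hm1.le])
  have hR2 : t * m₂ ≤ R₂ := by
    rw [← Real.sqrt_sq (by positivity : 0 ≤ t * m₂)]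
    exact Real.sqrt_le_sqrt (by nlinarith [mul_nonneg (mul_nonneg ht.le hb) hm2.le])
  have hsum : 0 < R₁ + R₂ := by nlinarith [mul_pos ht hm1, mul_pos ht hm2]
  have hsq1 : R₁ ^ 2 = t ^ 2 * m₁ ^ 2 + 2 * t * b * m₁ := Real.sq_sqrt (by positivity)
  have hsq2 : R₂ ^ 2 = t ^ 2 * m₂ ^ 2 + 2 * t * b * m₂ := Real.sq_sqrt (by positivity)
  -- `R₁ − R₂ = (R₁² − R₂²)/(R₁ + R₂)` and `R₁² − R₂² = (m₁ − m₂)(t²(m₁+m₂) + 2tb)`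
  have hkey : (R₁ - R₂) * (R₁ + R₂) = (m₁ - m₂) * (t ^ 2 * (m₁ + m₂) + 2 * t * b) := by nlinarith [hsq1, hsq2]
  have hquot : R₁ - R₂ = (m₁ - m₂) * ((t ^ 2 * (m₁ + m₂) + 2 * t * b) / (R₁ + R₂)) := by
    field_simp; linarith [hkey]
  rw [hquot, abs_mul, mul_comm]
  refine mul_le_mul_of_nonneg_right ?_ (abs_nonneg _)
  rw [abs_of_nonneg (by positivity)]
  rw [div_le_iff₀ hsum]
  -- `t²(m₁+m₂) + 2tb ≤ (t + b/μ)(R₁+R₂)` since `R₁+R₂ ≥ t(m₁+m₂) ≥ 2tμ`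
  have hA : t ^ 2 * (m₁ + m₂) ≤ t * (R₁ + R₂) := by nlinarith
  have hRR : 2 * t * μ ≤ R₁ + R₂ := by nlinarith
  have hB : 2 * t * b ≤ b / μ * (R₁ + R₂) :=
    calc 2 * t * b = b / μ * (2 * t * μ) := by field_simp
      _ ≤ b / μ * (R₁ + R₂) := mul_le_mul_of_nonneg_left hRR (by positivity)
  nlinarith

/-- ★ LIPSCHITZ: for `t > 0`, `b ≥ 0`, `μ_* > 0` and all `λ₁, λ₂`:
`|g(λ₁) − g(λ₂)| ≤ (3t/μ_*² + 3b/μ_*³)·|λ₁ − λ₂|`. [cite: Wipf2021, §8.5.1 (8.57)] -/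
theorem abs_riccatiWeight_sub_le {t b μ : ℝ} (hμ : 0 < μ) (ht : 0 < t) (hb : 0 ≤ b) (lam₁ lam₂ : ℝ) :
    |riccatiWeight t b μ lam₁ - riccatiWeight t b μ lam₂| ≤ (3 * t / μ ^ 2 + 3 * b / μ ^ 3) * |lam₁ - lam₂| := by
  rw [riccatiWeight_eq_div hμ, riccatiWeight_eq_div hμ]
  set m₁ := max lam₁ μ
  set m₂ := max lam₂ μ
  have h1 : μ ≤ m₁ := le_max_right _ _
  have h2 : μ ≤ m₂ := le_max_right _ _
  have hm1 : 0 < m₁ := hμ.trans_le h1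
  have hm2 : 0 < m₂ := hμ.trans_le h2
  have hΔ : |m₁ - m₂| ≤ |lam₁ - lam₂| := abs_max_sub_max_le_abs _ _ _
  set R₁ := Real.sqrt (t ^ 2 * m₁ ^ 2 + 2 * t * b * m₁)
  set R₂ := Real.sqrt (t ^ 2 * m₂ ^ 2 + 2 * t * b * m₂)
  have hR := abs_sqrt_rad_sub_le hμ ht hb h1 h2
  have hR2le : R₂ ≤ t * m₂ + b := by
    rw [← Real.sqrt_sq (by positivity : 0 ≤ t * m₂ + b)]
    exact Real.sqrt_le_sqrt (by nlinarith [sq_nonneg b])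
  have hR2nn : 0 ≤ R₂ := Real.sqrt_nonneg _
  -- split `R₁/m₁² − R₂/m₂² = (R₁ − R₂)/m₁² + R₂(1/m₁² − 1/m₂²)`
  have hsplit : R₁ / m₁ ^ 2 - R₂ / m₂ ^ 2 = (R₁ - R₂) / m₁ ^ 2 + R₂ * (m₂ - m₁) * (m₂ + m₁) / (m₁ ^ 2 * m₂ ^ 2) := by
    field_simp; ring
  rw [hsplit]
  refine (abs_add_le _ _).trans ?_
  -- first piece
  have hp1 : |(R₁ - R₂) / m₁ ^ 2| ≤ (t + b / μ) / μ ^ 2 * |lam₁ - lam₂| := by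
    rw [abs_div, abs_of_pos (by positivity : 0 < m₁ ^ 2), div_le_iff₀ (by positivity : 0 < m₁ ^ 2)]
    refine hR.trans ?_
    have hμm : μ ^ 2 ≤ m₁ ^ 2 := pow_le_pow_left₀ hμ.le h1 2
    calc (t + b / μ) * |m₁ - m₂| ≤ (t + b / μ) * |lam₁ - lam₂| := mul_le_mul_of_nonneg_left hΔ (by positivity)
      _ = (t + b / μ) / μ ^ 2 * |lam₁ - lam₂| * μ ^ 2 := by field_simp
      _ ≤ (t + b / μ) / μ ^ 2 * |lam₁ - lam₂| * m₁ ^ 2 := mul_le_mul_of_nonneg_left hμm (by positivity)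
  -- second piece
  have hμ1 : μ ^ 2 ≤ m₁ ^ 2 := pow_le_pow_left₀ hμ.le h1 2
  have hμ2 : μ ^ 2 ≤ m₂ ^ 2 := pow_le_pow_left₀ hμ.le h2 2
  have hi : t * m₂ * (m₂ + m₁) * μ ^ 2 ≤ 2 * t * (m₁ ^ 2 * m₂ ^ 2) := by
    have e1 : μ ^ 2 * m₂ ^ 2 ≤ m₁ ^ 2 * m₂ ^ 2 := mul_le_mul_of_nonneg_right hμ1 (sq_nonneg _)
    have e2 : μ ^ 2 * (m₁ * m₂) ≤ m₁ ^ 2 * m₂ ^ 2 := by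
      have : μ * μ ≤ m₁ * m₂ := mul_le_mul h1 h2 hμ.le hm1.le
      nlinarith [mul_pos hm1 hm2]
    nlinarith [mul_le_mul_of_nonneg_left e1 ht.le, mul_le_mul_of_nonneg_left e2 ht.le]
  have hii : b * (m₂ + m₁) * μ ^ 3 ≤ 2 * b * (m₁ ^ 2 * m₂ ^ 2) := by
    have e1 : μ ^ 3 * m₂ ≤ m₁ ^ 2 * m₂ ^ 2 := by
      have : μ ^ 2 * μ ≤ m₁ ^ 2 * m₂ := mul_le_mul hμ1 h2 hμ.le (sq_nonneg _)
      nlinarith [mul_pos (pow_pos hm1 2) hm2]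
    have e2 : μ ^ 3 * m₁ ≤ m₁ ^ 2 * m₂ ^ 2 := by
      have : μ * μ ^ 2 ≤ m₁ * m₂ ^ 2 := mul_le_mul h1 hμ2 (sq_nonneg _) hm1.le
      nlinarith [mul_pos hm1 (pow_pos hm2 2)]
    nlinarith [mul_le_mul_of_nonneg_left e1 hb, mul_le_mul_of_nonneg_left e2 hb]
  have hcoef : (t * m₂ + b) * (m₂ + m₁) ≤ (2 * t / μ ^ 2 + 2 * b / μ ^ 3) * (m₁ ^ 2 * m₂ ^ 2) := by
    have A : t * m₂ * (m₂ + m₁) ≤ 2 * t / μ ^ 2 * (m₁ ^ 2 * m₂ ^ 2) := by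
      rw [div_mul_eq_mul_div, le_div_iff₀ (pow_pos hμ 2)]; linarith [hi]
    have B : b * (m₂ + m₁) ≤ 2 * b / μ ^ 3 * (m₁ ^ 2 * m₂ ^ 2) := by
      rw [div_mul_eq_mul_div, le_div_iff₀ (pow_pos hμ 3)]; linarith [hii]
    have e : (t * m₂ + b) * (m₂ + m₁) = t * m₂ * (m₂ + m₁) + b * (m₂ + m₁) := by ring
    rw [e, add_mul]
    exact add_le_add A B
  have hp2 : |R₂ * (m₂ - m₁) * (m₂ + m₁) / (m₁ ^ 2 * m₂ ^ 2)| ≤ (2 * t / μ ^ 2 + 2 * b / μ ^ 3) * |lam₁ - lam₂| := by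
    rw [abs_div, abs_of_pos (by positivity : 0 < m₁ ^ 2 * m₂ ^ 2), abs_mul, abs_mul, abs_of_nonneg hR2nn,
      abs_of_pos (by positivity : 0 < m₂ + m₁), abs_sub_comm m₂ m₁, div_le_iff₀ (by positivity : 0 < m₁ ^ 2 * m₂ ^ 2)]
    have hΔ0 : 0 ≤ |m₁ - m₂| := abs_nonneg _
    calc R₂ * |m₁ - m₂| * (m₂ + m₁) = R₂ * (m₂ + m₁) * |m₁ - m₂| := by ring
      _ ≤ (t * m₂ + b) * (m₂ + m₁) * |lam₁ - lam₂| :=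
          mul_le_mul (mul_le_mul_of_nonneg_right hR2le (by positivity)) hΔ hΔ0 (by positivity)
      _ ≤ (2 * t / μ ^ 2 + 2 * b / μ ^ 3) * (m₁ ^ 2 * m₂ ^ 2) * |lam₁ - lam₂| :=
          mul_le_mul_of_nonneg_right hcoef (abs_nonneg _)
      _ = (2 * t / μ ^ 2 + 2 * b / μ ^ 3) * |lam₁ - lam₂| * (m₁ ^ 2 * m₂ ^ 2) := by ring
  have hsum : (t + b / μ) / μ ^ 2 + (2 * t / μ ^ 2 + 2 * b / μ ^ 3) = 3 * t / μ ^ 2 + 3 * b / μ ^ 3 := by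
    field_simp; ring
  calc |(R₁ - R₂) / m₁ ^ 2| + |R₂ * (m₂ - m₁) * (m₂ + m₁) / (m₁ ^ 2 * m₂ ^ 2)|
      ≤ (t + b / μ) / μ ^ 2 * |lam₁ - lam₂| + (2 * t / μ ^ 2 + 2 * b / μ ^ 3) * |lam₁ - lam₂| := add_le_add hp1 hp2
    _ = (3 * t / μ ^ 2 + 3 * b / μ ^ 3) * |lam₁ - lam₂| := by rw [← add_mul, hsum]

end Summit.QuantumFields.YangMills.Theorems.FemtoTransferGap.TwoLattice.Harm

end
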